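import Mathlib
import Literature.Computability.AlgebraicComplexity.PermanentIrreducible
import HarnessLib

/-!
# DefinabilityGap — LABEL SUPPORT, stage E1: the zero-pattern permanent is prime

Route `route-ValiantsHypothesis-DefinabilityGap` (DRAFT), read-once leaf F4 / W10 (aside `KIPlantedHittingRO`,
stmt-ValiantsHypothesis-23704), leaf `ZperHits₂(m)` = hypothesis `hZ` of
`DefinabilityGapZperTransfer.chainVal_eq_zero_of_bind₁_kiPer`.  LABEL SUPPORT (decomp-valiant bus, OFFER O-L5-LS
l.1198 / CALL l.1209): for `c < m` and `|S| ≤ m - 2`, no width-2 chain of univariate-image links whose NON-UNIT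
links have labels supported in the cell set `S` computes a non-zero multiple of `per_m`.  Specialising
`y_s ↦ constant (s ∈ S)` sends `per_m` to a polynomial whose top form is the ZERO-PATTERN PERMANENT
`Q_S = ∑_{σ avoiding S} ∏_i Y_(σ i, i)` (`zpPer`).  This file (E1 of E1 / E2 / E3; `Literature` + `Mathlib`
imports only) proves: coefficients / homogeneity / multilinearity of `Q_S`, `Q_∅ = per_m`; CELL COVERAGE (for
`|S| ≤ m - 2` every off-`S` cell lies on an avoiding permutation — the `m - 1` cyclic diagonals of its minor are
pairwise disjoint, pigeonhole); OWNERSHIP (`Q_S = A·B` ⇒ no variable of `B` in the row / column of a variable of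
`A`, via `∂_x Q_S = (∂_x A)·B`), RECTANGLES (`rows A × cols B ⊆ S`), COUNTING (`|S| ≥ 2m - 2` unless a factor is
constant); **Theorem** `zpPer_irreducible` / `zpPer_prime`: `Q_S` is irreducible (prime) over every field for
`|S| + 2 ≤ m` — Brualdi–Ryser 1991 Thm. 9.2.4 with the remark (p. 297) that it «remains true for the permanent
function» (≤ `m - 2` prescribed zeros ⇒ fully indecomposable ⇒ irreducible); the tree had `S = ∅` only
(`perPoly_irreducible`, von zur Gathen 1987 Thm. 3.4).  HONEST GRADE (critic, l.1209): KNOWN, kernel-new; a lemma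
for E2 / E3; closes no item; 0 S-currency; rung 0; VP ≠ VNP untouched. No facts, no Prop-valued definitions.
-/

-- single-conjunct layout `Summits/ValiantsHypothesis/ValiantsHypothesis`: the duplicated namespace
-- component is mandated by the tree.
set_option linter.dupNamespace false

open MvPolynomial Finset
open Literature.Computability.AlgebraicComplexity

namespace Summit.ValiantsHypothesis.ValiantsHypothesis.Theorems.DefinabilityGapZeroPatternPermanent

noncomputable section

variable {m : ℕ}

/-! ## 1. Permutations avoiding a set of cells; the zero-pattern permanent -/

/-- The permutations `ρ` of `Fin m` whose cells `(ρ i, i)` all avoid `S`. [cite: BrualdiRyser1991, Thm. 9.2.4] -/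
def avoid (S : Finset (Fin m × Fin m)) : Finset (Equiv.Perm (Fin m)) :=
  univ.filter fun ρ => ∀ i, (ρ i, i) ∉ S

/-- Membership in `avoid S`. [this file] -/
theorem mem_avoid {S : Finset (Fin m × Fin m)} {ρ : Equiv.Perm (Fin m)} :
    ρ ∈ avoid S ↔ ∀ i, (ρ i, i) ∉ S := by
  simp [avoid]

/-- Every permutation avoids `∅`. [this file] -/
theorem avoid_empty : avoid (∅ : Finset (Fin m × Fin m)) = univ := by
  ext ρ; simp [avoid]

variable (R : Type*) [CommSemiring R]

/-- The ZERO-PATTERN PERMANENT `Q_S = ∑_{ρ avoiding S} ∏_i X_(ρ i, i)`: the permanent of the generic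
matrix with zeros at the cells of `S`. [cite: BrualdiRyser1991, Thm. 9.2.4] -/
def zpPer (S : Finset (Fin m × Fin m)) : MvPolynomial (Fin m × Fin m) R :=
  ∑ ρ ∈ avoid S, ∏ i, X (ρ i, i)

/-- `Q_S = ∑_{ρ avoiding S} X^{μ_ρ}`. [this file] -/
theorem zpPer_eq_sum_monomial (S : Finset (Fin m × Fin m)) :
    zpPer R S = ∑ ρ ∈ avoid S, monomial (permMonomial ρ) (1 : R) := by
  refine Finset.sum_congr rfl fun ρ _ => ?_
  rw [permMonomial, monomial_sum_one]
  rfl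

/-- `Q_∅ = per_m`. [this file] -/
theorem zpPer_empty : zpPer R (∅ : Finset (Fin m × Fin m)) = perPoly (Fin m) R := by
  rw [zpPer_eq_sum_monomial, avoid_empty, perPoly_eq_sum_monomial]

/-- The coefficients of `Q_S`. [this file] -/
theorem coeff_zpPer (S : Finset (Fin m × Fin m)) (d : (Fin m × Fin m) →₀ ℕ) :
    coeff d (zpPer R S) = ∑ ρ ∈ avoid S, if permMonomial ρ = d then (1 : R) else 0 := by
  rw [zpPer_eq_sum_monomial, coeff_sum]
  simp only [coeff_monomial]

/-- The permutation monomial of `ρ` has coefficient `[ρ avoids S]` in `Q_S`. [this file] -/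
theorem coeff_permMonomial_zpPer (S : Finset (Fin m × Fin m)) (ρ : Equiv.Perm (Fin m)) :
    coeff (permMonomial ρ) (zpPer R S) = if ρ ∈ avoid S then (1 : R) else 0 := by
  classical
  rw [coeff_zpPer]
  simp_rw [permMonomial_injective.eq_iff]
  simp

/-- The support of `Q_S` consists of permutation monomials of avoiding permutations. [this file] -/
theorem exists_perm_of_coeff_zpPer_ne_zero {S : Finset (Fin m × Fin m)} {d : (Fin m × Fin m) →₀ ℕ}
    (h : coeff d (zpPer R S) ≠ 0) : ∃ ρ ∈ avoid S, permMonomial ρ = d := by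
  rw [coeff_zpPer] at h
  obtain ⟨ρ, hρ, hne⟩ := Finset.exists_ne_zero_of_sum_ne_zero h
  exact ⟨ρ, hρ, by by_contra h'; exact hne (if_neg h')⟩

/-- `Q_S` is homogeneous of degree `m`. [this file] -/
theorem zpPer_isHomogeneous (S : Finset (Fin m × Fin m)) : (zpPer R S).IsHomogeneous m := by
  refine IsHomogeneous.sum _ _ _ fun ρ _ => ?_
  have := IsHomogeneous.prod (φ := fun i : Fin m => (X (ρ i, i) : MvPolynomial (Fin m × Fin m) R))
    univ (fun _ => 1) fun i _ => isHomogeneous_X R (ρ i, i)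
  simpa using this

/-- `Q_S` is multilinear. [this file] -/
theorem degreeOf_zpPer_le (S : Finset (Fin m × Fin m)) (x : Fin m × Fin m) :
    degreeOf x (zpPer R S) ≤ 1 := by
  classical
  rw [degreeOf_le_iff]
  intro d hd
  obtain ⟨ρ, -, rfl⟩ := exists_perm_of_coeff_zpPer_ne_zero R (mem_support_iff.1 hd)
  obtain ⟨r, c⟩ := x
  rw [permMonomial_apply]
  split_ifs <;> simp

/-! ## 2. Cell coverage: `|S| ≤ m - 2` -/

variable {R}

/-- An injective line of `m` cells keeps a cell off `S` when `|S| ≤ m - 2`. [this file] -/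
theorem exists_off_line {S : Finset (Fin m × Fin m)} (hS : S.card + 2 ≤ m) {f : Fin m → Fin m × Fin m}
    (hf : Function.Injective f) : ∃ i, f i ∉ S := by
  by_contra h; push Not at h
  have := Finset.card_le_card_of_injOn (s := (univ : Finset (Fin m))) (t := S) f
    (fun i _ => by simpa using h i) hf.injOn
  rw [card_univ, Fintype.card_fin] at this; omega

/-- Every row, and every column, keeps a cell off `S` when `|S| ≤ m - 2`. [this file] -/
theorem exists_off_row {S : Finset (Fin m × Fin m)} (hS : S.card + 2 ≤ m) (k : Fin m) :
    ∃ i, (k, i) ∉ S :=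
  exists_off_line hS fun _ _ h => (Prod.mk.inj h).2

/-- (columns) [this file] -/
theorem exists_off_col {S : Finset (Fin m × Fin m)} (hS : S.card + 2 ≤ m) (i : Fin m) :
    ∃ k, (k, i) ∉ S :=
  exists_off_line hS fun _ _ h => (Prod.mk.inj h).1

/-- CELL COVERAGE: for `|S| ≤ m - 2` every cell `x ∉ S` lies on a permutation avoiding `S` — the `m - 1`
cyclic diagonals of the minor of `x`, completed through `x`, are permutations whose other cells are pairwise
disjoint, and they cannot all meet `S`. [cite: BrualdiRyser1991, Thm. 9.2.4] -/
theorem exists_mem_avoid_apply_eq {S : Finset (Fin m × Fin m)} (hS : S.card + 2 ≤ m)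
    {x : Fin m × Fin m} (hx : x ∉ S) : ∃ ρ ∈ avoid S, ρ x.2 = x.1 := by
  classical
  obtain ⟨n, rfl⟩ : ∃ n, m = n + 2 := ⟨m - 2, by omega⟩
  obtain ⟨k, i⟩ := x
  -- the cyclic diagonals of the minor of `(k, i)`, completed through `(k, i)`
  let σ : Fin (n + 1) → Equiv.Perm (Fin (n + 2)) := fun j =>
    (finSuccEquiv' i).trans ((Equiv.optionCongr (Equiv.addRight j)).trans (finSuccEquiv' k).symm)
  have hσi : ∀ j, σ j i = k := fun j => by
    simp [σ, finSuccEquiv'_at, finSuccEquiv'_symm_none]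
  have hσs : ∀ j t, σ j (i.succAbove t) = k.succAbove (t + j) := fun j t => by
    simp [σ, finSuccEquiv'_succAbove, finSuccEquiv'_symm_some]
  by_contra hno
  have hmeet : ∀ j, ∃ t : Fin (n + 1), (k.succAbove (t + j), i.succAbove t) ∈ S := by
    intro j
    by_contra hj
    push Not at hj
    refine hno ⟨σ j, mem_avoid.2 fun i' => ?_, hσi j⟩
    by_cases hi' : i' = i
    · rw [hi', hσi]; exact hx
    · obtain ⟨t, rfl⟩ := Fin.exists_succAbove_eq hi'
      rw [hσs]; exact hj t
  choose t ht using hmeet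
  -- `j ↦` the meeting cell is an injection `Fin (n + 1) ↪ S`
  have hinj : Function.Injective fun j : Fin (n + 1) => (k.succAbove (t j + j), i.succAbove (t j)) := by
    intro j j' h
    simp only [Prod.mk.injEq] at h
    obtain ⟨h1, h2⟩ := h
    have ht' : t j = t j' := Fin.succAbove_right_injective h2
    have h1' : t j + j = t j' + j' := Fin.succAbove_right_injective h1
    rw [ht'] at h1'
    exact add_left_cancel h1'
  have hcard := Finset.card_le_card_of_injOn (s := (univ : Finset (Fin (n + 1)))) (t := S) _
    (fun j _ => by simpa using ht j) (hinj.injOn)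
  rw [card_univ, Fintype.card_fin] at hcard
  omega

variable (R)

/-- Every cell off `S` is a variable of `Q_S` (`|S| ≤ m - 2`). [this file] -/
theorem mem_vars_zpPer [Nontrivial R] {S : Finset (Fin m × Fin m)} (hS : S.card + 2 ≤ m)
    {x : Fin m × Fin m} (hx : x ∉ S) : x ∈ (zpPer R S).vars := by
  classical
  obtain ⟨ρ, hρ, hρx⟩ := exists_mem_avoid_apply_eq hS hx
  rw [mem_vars_iff_mem_support]
  refine ⟨permMonomial ρ, ?_, ?_⟩
  · rw [mem_support_iff, coeff_permMonomial_zpPer, if_pos hρ]; exact one_ne_zero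
  · obtain ⟨k, i⟩ := x
    rw [Finsupp.mem_support_iff, permMonomial_apply, if_pos hρx]; exact one_ne_zero

/-- `Q_S ≠ 0` for `|S| ≤ m - 2`. [this file] -/
theorem zpPer_ne_zero [Nontrivial R] {S : Finset (Fin m × Fin m)} (hS : S.card + 2 ≤ m) :
    zpPer R S ≠ 0 := by
  classical
  obtain ⟨i, hx⟩ := exists_off_row hS ⟨0, by omega⟩
  intro h
  have hv := mem_vars_zpPer R hS hx
  rw [h, vars_0] at hv; exact Finset.notMem_empty _ hv

/-! ## 3. Ownership: a factorisation of `Q_S` separates rows and columns -/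

section Domain

variable {R} {D : Type*} [CommRing D]

/-- A polynomial without variables is a constant. [folklore] -/
theorem eq_C_of_vars_eq_empty {τ : Type*} {p : MvPolynomial τ D} (h : p.vars = ∅) :
    p = C (coeff 0 p) := by
  classical
  refine eq_C_of_support_subset_zero fun d hd => ?_
  ext v
  rw [Finsupp.zero_apply]; by_contra hv
  have : v ∈ p.vars := (mem_vars_iff_mem_support v).2 ⟨d, hd, Finsupp.mem_support_iff.2 hv⟩
  rw [h] at this; exact Finset.notMem_empty _ this

/-- A polynomial of degree `≤ 1` in an occurring variable has a non-zero derivative in it. [folklore] -/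
theorem pderiv_ne_zero_of_mem_vars {τ : Type*} {p : MvPolynomial τ D} {x : τ} (hx : x ∈ p.vars)
    (h1 : p.degreeOf x ≤ 1) : pderiv x p ≠ 0 := by
  classical
  rw [mem_vars_iff_mem_support] at hx
  obtain ⟨d, hd, hxd⟩ := hx
  have hdx : d x = 1 :=
    le_antisymm ((monomial_le_degreeOf x hd).trans h1) (Nat.one_le_iff_ne_zero.mpr
      (Finsupp.mem_support_iff.mp hxd))
  intro h0
  have hc := congrArg (coeff (d - Finsupp.single x 1)) h0
  rw [coeff_pderiv, coeff_zero] at hc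
  have hds : d - Finsupp.single x 1 + Finsupp.single x 1 = d :=
    tsub_add_cancel_of_le (Finsupp.single_le_iff.2 (by rw [hdx]))
  have hdx0 : (d - Finsupp.single x 1 : τ →₀ ℕ) x = 0 := by
    rw [Finsupp.tsub_apply, Finsupp.single_eq_same, hdx]
  rw [hds, hdx0, Nat.cast_zero, zero_add, mul_one] at hc
  exact (mem_support_iff.mp hd) hc

/-- The variables of `∂ Q_S / ∂ Y_x` lie off the row and off the column of `x` (every monomial of `Q_S`
through `x` is a permutation monomial). [this file] -/
theorem off_line_of_mem_vars_pderiv {S : Finset (Fin m × Fin m)} {x y : Fin m × Fin m}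
    (hy : y ∈ (pderiv x (zpPer D S)).vars) : y.1 ≠ x.1 ∧ y.2 ≠ x.2 := by
  classical
  rw [mem_vars_iff_mem_support] at hy
  obtain ⟨d, hd, hyd⟩ := hy
  rw [mem_support_iff, coeff_pderiv] at hd
  obtain ⟨ρ, -, hρ⟩ := exists_perm_of_coeff_zpPer_ne_zero D (left_ne_zero_of_mul hd)
  rw [Finsupp.mem_support_iff] at hyd
  obtain ⟨k, i⟩ := x
  obtain ⟨r, c⟩ := y
  have hki : ρ i = k := by
    have := DFunLike.congr_fun hρ (k, i)
    rw [permMonomial_apply, Finsupp.add_apply, Finsupp.single_eq_same] at this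
    by_contra h; rw [if_neg h] at this; omega
  have hrc : ρ c = r := by
    have := DFunLike.congr_fun hρ (r, c)
    rw [permMonomial_apply, Finsupp.add_apply] at this
    by_contra h; rw [if_neg h] at this; omega
  have hne : (r, c) ≠ (k, i) := by
    intro heq
    have := DFunLike.congr_fun hρ (k, i)
    rw [permMonomial_apply, Finsupp.add_apply, Finsupp.single_eq_same, if_pos hki] at this
    rw [heq] at hyd; omega
  refine ⟨fun hrk => hne ?_, fun hci => hne ?_⟩
  · simp only at hrk; subst hrk
    rw [show c = i from ρ.injective (hrc.trans hki.symm)]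
  · simp only at hci; subst hci
    rw [← hrc, hki]

variable [IsDomain D]

/-- OWNERSHIP: if `Q_S = A · B`, no variable of `B` lies in the row or in the column of a variable of `A`
(`∂_x Q_S = (∂_x A) · B`, degrees add on products). [this file] -/
theorem off_line_of_factor {S : Finset (Fin m × Fin m)} {A B : MvPolynomial (Fin m × Fin m) D}
    (hAB : zpPer D S = A * B) {x y : Fin m × Fin m} (hx : x ∈ A.vars) (hy : y ∈ B.vars) :
    y.1 ≠ x.1 ∧ y.2 ≠ x.2 := by
  classical
  have hA : A ≠ 0 := fun h => by rw [h, vars_0] at hx; exact Finset.notMem_empty _ hx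
  have hB : B ≠ 0 := fun h => by rw [h, vars_0] at hy; exact Finset.notMem_empty _ hy
  have hdeg : degreeOf x A + degreeOf x B ≤ 1 := by
    rw [← degreeOf_mul_eq hA hB, ← hAB]; exact degreeOf_zpPer_le D S x
  have hxA := mem_vars_iff_degreeOf_ne_zero.mp hx
  have hxB : x ∉ B.vars := fun h => by
    have := mem_vars_iff_degreeOf_ne_zero.mp h; omega
  have hprod : pderiv x (zpPer D S) = pderiv x A * B := by
    rw [hAB, pderiv_mul, pderiv_eq_zero_of_notMem_vars hxB, mul_zero, add_zero]
  have hA' : pderiv x A ≠ 0 := pderiv_ne_zero_of_mem_vars hx (by omega)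
  apply off_line_of_mem_vars_pderiv (D := D) (S := S)
  rw [hprod, mem_vars_iff_degreeOf_ne_zero, degreeOf_mul_eq hA' hB]
  have := mem_vars_iff_degreeOf_ne_zero.mp hy
  omega

/-- RECTANGLES: if `Q_S = A · B` (`|S| ≤ m - 2`), `x` a variable of `A` and `y` a variable of `B`, then the
cell `(row x, col y)` belongs to `S` (it is off both factors' reach, but off-`S` cells are variables).
[this file] -/
theorem mem_of_factor {S : Finset (Fin m × Fin m)} (hS : S.card + 2 ≤ m)
    {A B : MvPolynomial (Fin m × Fin m) D} (hAB : zpPer D S = A * B) {x y : Fin m × Fin m}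
    (hx : x ∈ A.vars) (hy : y ∈ B.vars) : (x.1, y.2) ∈ S := by
  classical
  by_contra hz
  have hzv : (x.1, y.2) ∈ (zpPer D S).vars := mem_vars_zpPer D hS hz; rw [hAB] at hzv
  rcases Finset.mem_union.1 (vars_mul A B hzv) with hzA | hzB
  · exact (off_line_of_factor hAB hzA hy).2 rfl
  · exact (off_line_of_factor hAB hx hzB).1 rfl

/-- COUNTING: a factorisation `Q_S = A · B` with both factors non-constant forces `|S| ≥ 2m - 2`,
impossible for `|S| ≤ m - 2` (rows and columns split `R_A ⊔ R_B`, `C_A ⊔ C_B`, and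
`R_A × C_B ∪ R_B × C_A ⊆ S`). [cite: BrualdiRyser1991, Thm. 9.2.4] -/
theorem false_of_factor {S : Finset (Fin m × Fin m)} (hS : S.card + 2 ≤ m)
    {A B : MvPolynomial (Fin m × Fin m) D} (hAB : zpPer D S = A * B) (hA : A.vars.Nonempty)
    (hB : B.vars.Nonempty) : False := by
  classical
  have hBA : zpPer D S = B * A := by rw [hAB, mul_comm]
  set RA := A.vars.image Prod.fst
  set RB := B.vars.image Prod.fst
  set CA := A.vars.image Prod.snd
  set CB := B.vars.image Prod.snd
  -- rows and columns split …
  have hRd : Disjoint RA RB := by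
    rw [Finset.disjoint_left]; intro k hkA hkB
    obtain ⟨x, hx, rfl⟩ := Finset.mem_image.1 hkA
    obtain ⟨y, hy, hyx⟩ := Finset.mem_image.1 hkB
    exact (off_line_of_factor hAB hx hy).1 hyx
  have hCd : Disjoint CA CB := by
    rw [Finset.disjoint_left]; intro i hiA hiB
    obtain ⟨x, hx, rfl⟩ := Finset.mem_image.1 hiA
    obtain ⟨y, hy, hyx⟩ := Finset.mem_image.1 hiB
    exact (off_line_of_factor hAB hx hy).2 hyx
  -- … and are covered (off-`S` cells are variables of `A` or of `B`)
  have cover : ∀ z, z ∉ S → z ∈ A.vars ∪ B.vars := fun z hz =>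
    vars_mul A B (hAB ▸ mem_vars_zpPer D hS hz)
  have hRc : RA ∪ RB = univ := Finset.eq_univ_iff_forall.2 fun k => by
    obtain ⟨i, hki⟩ := exists_off_row hS k
    rcases Finset.mem_union.1 (cover _ hki) with h | h
    · exact Finset.mem_union_left _ (Finset.mem_image_of_mem Prod.fst h)
    · exact Finset.mem_union_right _ (Finset.mem_image_of_mem Prod.fst h)
  have hCc : CA ∪ CB = univ := Finset.eq_univ_iff_forall.2 fun i => by
    obtain ⟨k, hki⟩ := exists_off_col hS i
    rcases Finset.mem_union.1 (cover _ hki) with h | h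
    · exact Finset.mem_union_left _ (Finset.mem_image_of_mem Prod.snd h)
    · exact Finset.mem_union_right _ (Finset.mem_image_of_mem Prod.snd h)
  have rect : ∀ {A' B' : MvPolynomial (Fin m × Fin m) D}, zpPer D S = A' * B' →
      ∀ z ∈ (A'.vars.image Prod.fst) ×ˢ (B'.vars.image Prod.snd), z ∈ S := by
    rintro A' B' h ⟨k, i⟩ hz
    obtain ⟨hk, hi⟩ := Finset.mem_product.1 hz
    obtain ⟨x, hx, rfl⟩ := Finset.mem_image.1 hk
    obtain ⟨y, hy, rfl⟩ := Finset.mem_image.1 hi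
    exact mem_of_factor hS h hx hy
  have hrect : RA ×ˢ CB ∪ RB ×ˢ CA ⊆ S := fun z hz =>
    (Finset.mem_union.1 hz).elim (rect hAB z) (rect hBA z)
  have hd2 : Disjoint (RA ×ˢ CB) (RB ×ˢ CA) := by
    rw [Finset.disjoint_left]; rintro ⟨k, i⟩ h1 h2
    rw [Finset.mem_product] at h1 h2
    exact Finset.disjoint_left.1 hRd h1.1 h2.1
  have hcount : RA.card * CB.card + RB.card * CA.card ≤ S.card := by
    have := Finset.card_le_card hrect
    rwa [Finset.card_union_of_disjoint hd2, Finset.card_product, Finset.card_product] at this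
  have hR : RA.card + RB.card = m := by
    rw [← Finset.card_union_of_disjoint hRd, hRc, card_univ, Fintype.card_fin]
  have hC : CA.card + CB.card = m := by
    rw [← Finset.card_union_of_disjoint hCd, hCc, card_univ, Fintype.card_fin]
  have h1 : 0 < RA.card := Finset.card_pos.2 (hA.image _)
  have h2 : 0 < RB.card := Finset.card_pos.2 (hB.image _)
  have h3 : 0 < CA.card := Finset.card_pos.2 (hA.image _)
  have h4 : 0 < CB.card := Finset.card_pos.2 (hB.image _)
  nlinarith

/-! ## 4. Irreducibility and primality (over a field) -/

variable {K : Type*} [Field K]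

/-- A non-zero polynomial without variables is a unit (field coefficients). [folklore] -/
theorem isUnit_of_vars_eq_empty {τ : Type*} {p : MvPolynomial τ K} (hp : p ≠ 0) (h : p.vars = ∅) :
    IsUnit p := by
  rw [eq_C_of_vars_eq_empty h] at hp ⊢
  exact (IsUnit.mk0 _ fun h0 => hp (by rw [h0, C_0])).map C

/-- **The zero-pattern permanent is irreducible** for `|S| ≤ m - 2` (Brualdi–Ryser 1991, Thm. 9.2.4 and the
remark that it remains true for the permanent: at most `m - 2` prescribed zeros leave a generic matrix fully
indecomposable). [cite: BrualdiRyser1991, Thm. 9.2.4] -/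
theorem zpPer_irreducible {S : Finset (Fin m × Fin m)} (hS : S.card + 2 ≤ m) :
    Irreducible (zpPer K S) := by
  classical
  obtain ⟨i, hx⟩ := exists_off_row hS ⟨0, by omega⟩
  have hxv := mem_vars_zpPer K hS hx
  refine ⟨fun hu => ?_, fun A B hAB => ?_⟩
  · obtain ⟨r, -, hr⟩ := isUnit_iff_eq_C_of_isReduced.mp hu
    rw [hr, vars_C] at hxv
    exact Finset.notMem_empty _ hxv
  · have h0 : A * B ≠ 0 := hAB ▸ zpPer_ne_zero K hS
    by_cases hA : A.vars = ∅
    · exact Or.inl (isUnit_of_vars_eq_empty (left_ne_zero_of_mul h0) hA)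
    by_cases hB : B.vars = ∅
    · exact Or.inr (isUnit_of_vars_eq_empty (right_ne_zero_of_mul h0) hB)
    exact (false_of_factor hS hAB (Finset.nonempty_iff_ne_empty.2 hA)
      (Finset.nonempty_iff_ne_empty.2 hB)).elim

/-- Hence `Q_S` is PRIME for `|S| ≤ m - 2` (`K[Y]` is factorial). [cite: BrualdiRyser1991, Thm. 9.2.4] -/
theorem zpPer_prime {S : Finset (Fin m × Fin m)} (hS : S.card + 2 ≤ m) : Prime (zpPer K S) :=
  UniqueFactorizationMonoid.irreducible_iff_prime.mp (zpPer_irreducible hS)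

end Domain

end

end Summit.ValiantsHypothesis.ValiantsHypothesis.Theorems.DefinabilityGapZeroPatternPermanent
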